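import Literature.Algebra.Homology.OrderedCechPairSystemComplexAugment
import Literature.Algebra.Homology.BicomplexSingleColumn
import HarnessLib

/-!
# A resolution of a pair-system by a complex of pair-systems: `Tot Č•,•(P) ⟶ Tot V(Q)` and the comparison of `Tot Č•,•(P)` with the
# corner complex `q ↦ Q^q ∅ ∅` (Stacks 0BEC, 0133, 012Z)

Layer `Literature/Algebra/Homology` (constructions + proved lemmas; 0 named facts, no instance, no notation; pure homological algebra
over a commutative ring `A`). Data: a pair-system `P`, a cochain complex of pair-systems `Q` and an augmentation `ε : P ⟶ Q⁰` with
`ε ≫ d_Q = 0` (all abstract; `Algebra/Homology/OrderedCechPairSystemComplex(Augment)` for `cechTricomplex Q`, the bicomplex of totals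
`V = cechTotBicomplex Q`, the `∅`-column bicomplex `W' = emptyColBicomplex Q`, the corner complex `Γ• = emptyComplex Q`).

* `colAugment ε hε a : (Č^{a,•}(P))[0] ⟶ (q ↦ Č^{a,•}(Q^q))` — the column `a` of `Č•,•(P)` as a one-COLUMN bicomplex
  (`Algebra/Homology/BicomplexSingleColumn`) mapping to the column `a` of the flip of `cechTricomplex Q` by `Č•,•(ε)` (Mathlib
  `mkHomFromSingle`); `colAugment_comm` (the `a`-squares are those of `Č•,•(ε)`);
* **`resAugment ε hε : Č•,•(P) ⟶ V`** (`f a = ιTotalSingleColumn ≫ Tot(colAugment a)`), `quasiIso_total_map_colAugment_of_rows`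
  (ROWS criterion `TotalQuasiIsoOfBoundedColumns.quasiIso_total_map_of_quasiIso_rows_of_isStrictlyGE` under the row hypotheses (H1′):
  every row `(Čᵃ,ᵇ(P))[0] ⟶ (q ↦ Čᵃ,ᵇ(Q^q))` of `colAugment a` is a quasi-isomorphism) and **`quasiIso_total_map_resAugment`**
  (columns criterion);
* **`homologyIsoEmptyComplex`** — under `[Q.IsStrictlyGE 0]`, (H1′), (H2col) and (H2∅) (all binders), the canonical isomorphisms
  `Hⁿ(Tot Č•,•(P)) ≅ Hⁿ(Γ•)` through the zig-zag of quasi-isomorphisms `Tot Č•,•(P) ⟶ Tot V ⟵ Tot(W'ᶠˡⁱᵖ) ≅ Tot W' ⟵ Γ•`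
  (`resAugment`, `colTotAugment`, Mathlib's `totalFlipIso`, `emptyToTotal`; `isoOfQuasiIsoAt`).

This is the abstract form of «the double Čech complex computes what the corner complex computes» for a resolution datum; no scheme,
sheaf or cohomology statement is made. Library only (cell `pub-hodge-ring2`, count-neutral); proves nothing about any crux, route or
conjecture. Mathlib searched (pin v4.32): `HomologicalComplex.mkHomFromSingle` (+ `_f`), `from_single_hom_ext`, `single_map_f_self`,
`HomologicalComplex₂.flipFunctor`, `totalFlipIso`, `isoOfQuasiIsoAt`, `homologyFunctor` (used).

## References

* The Stacks Project, Tag 0BEC (Künneth: the double Čech complex), Tag 0133 (double complexes with exact rows/columns), Tag 012Z. [StacksProject]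
* C. A. Weibel, *An introduction to homological algebra* (1994), 5.6.1–5.6.2, 2.7.3 (acyclic assembly). [Weibel1994]
-/

universe u

open CategoryTheory HomologicalComplex

set_option backward.isDefEq.respectTransparency false

noncomputable section

namespace Literature.Algebra.Homology

namespace OrderedCech

variable {A : Type u} [CommRing A] {ι κ : Type} [LinearOrder ι] [LinearOrder κ]
  {P : Finset ι ⥤ Finset κ ⥤ ModuleCat.{u} A} {Q : CochainComplex (Finset ι ⥤ Finset κ ⥤ ModuleCat.{u} A) ℤ}
  (ε : P ⟶ Q.X 0) (hε : ε ≫ Q.d 0 1 = 0)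

/-! ### §1 The columns of `Č•,•(P)` augment the columns of the flip of `cechTricomplex Q` -/

/-- **`(Č^{a,•}(P))[0] ⟶ (q ↦ Č^{a,•}(Q^q))`**: the column `a` of `Č•,•(P)`, as a one-column bicomplex, maps to the column `a` of
`(cechTricomplex Q).flip` by the column `a` of `Č•,•(ε)` (`mkHomFromSingle`; `Č•,•(ε) ≫ Č•,•(d_Q) = Č•,•(ε ≫ d_Q) = 0`).
[cite: StacksProject, Tag 0BEC] [cite: StacksProject, Tag 0133] -/
def colAugment (a : ℤ) : singleColumnBicomplex ((sysBicomplex P).X a) ⟶ (cechTricomplex Q).flip.X a :=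
  mkHomFromSingle ((sysBicomplexMap ε).f a) fun q hq => by
    obtain rfl : (0 : ℤ) + 1 = q := hq
    change (sysBicomplexMap ε).f a ≫ (sysBicomplexMap (Q.d 0 1)).f a = 0
    rw [← comp_f, ← sysBicomplexMap_comp, hε, sysBicomplexMap_zero, zero_f]

/-- The degree-`0` column of `colAugment` is `Č•,•(ε)` in column `a` (up to `singleObjXSelf`). [cite: StacksProject, Tag 0BEC] -/
@[simp] theorem colAugment_f_zero (a : ℤ) :
    (colAugment ε hε a).f 0 = (singleObjXSelf (ComplexShape.up ℤ) 0 ((sysBicomplex P).X a)).hom ≫ (sysBicomplexMap ε).f a :=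
  mkHomFromSingle_f _ _

/-- The `a`-squares of the `colAugment`s are those of the morphism of bicomplexes `Č•,•(ε)`. [cite: StacksProject, Tag 0BEC] -/
theorem colAugment_comm (a : ℤ) :
    colAugment ε hε a ≫ (cechTricomplex Q).flip.d a (a + 1) =
      (singleColumnFunctor _).map ((sysBicomplex P).d a (a + 1)) ≫ colAugment ε hε (a + 1) := by
  apply from_single_hom_ext
  rw [comp_f, comp_f, colAugment_f_zero, single_map_f_self, Category.assoc, Category.assoc, Category.assoc,
    colAugment_f_zero, Iso.inv_hom_id_assoc]
  congr 1
  exact (sysBicomplexMap ε).comm a (a + 1)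

/-! ### §2 `Č•,•(P) ⟶ V` -/

/-- **`Č•,•(P) ⟶ V`**: in column `a`, `Č^{a,•}(P) ≅ Tot((Č^{a,•}(P))[0]) ⟶ Tot_{(q,b)} Čᵃ,ᵇ(Q^q)`; the `a`-squares are the naturality of
`ιTotalSingleColumn` (`Algebra/Homology/BicomplexSingleColumn`) and `colAugment_comm`. [cite: StacksProject, Tag 0BEC] [cite: StacksProject, Tag 012Z] -/
def resAugment : sysBicomplex P ⟶ cechTotBicomplex Q where
  f a := ιTotalSingleColumn ((sysBicomplex P).X a) ≫ HomologicalComplex₂.total.map (colAugment ε hε a) (ComplexShape.up ℤ)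
  comm' a a' haa' := by
    obtain rfl : a + 1 = a' := haa'
    rw [cechTotBicomplex_d, Category.assoc, ← HomologicalComplex₂.total.map_comp, colAugment_comm,
      HomologicalComplex₂.total.map_comp, ← Category.assoc, ← ιTotalSingleColumn_naturality, Category.assoc]

/-- The columns of `resAugment` (`rfl`). [cite: StacksProject, Tag 0BEC] -/
@[simp] theorem resAugment_f (a : ℤ) :
    (resAugment ε hε).f a = ιTotalSingleColumn ((sysBicomplex P).X a) ≫
      HomologicalComplex₂.total.map (colAugment ε hε a) (ComplexShape.up ℤ) := rfl

/-- **Rows criterion for the columns**: if every ROW `(Čᵃ,ᵇ(P))[0] ⟶ (q ↦ Čᵃ,ᵇ(Q^q))` of `colAugment a` is a quasi-isomorphism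
(hypothesis (H1′): the members of `Q` resolve those of `P`, read on cochain modules), then `Tot(colAugment a)` is a quasi-isomorphism,
for `Q` in degrees `≥ 0`. [cite: StacksProject, Tag 0133] [cite: Weibel1994, 5.6.1–5.6.2] -/
theorem quasiIso_total_map_colAugment_of_rows [Q.IsStrictlyGE 0] (a : ℤ)
    (hrow : ∀ b : ℤ, QuasiIso (((HomologicalComplex₂.flipFunctor _ (ComplexShape.up ℤ) (ComplexShape.up ℤ)).map
      (colAugment ε hε a)).f b)) :
    QuasiIso (HomologicalComplex₂.total.map (colAugment ε hε a) (ComplexShape.up ℤ)) := by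
  haveI : CochainComplex.IsStrictlyGE ((sysBicomplex P).X a) 0 := isStrictlyGE_sysBicomplex_X P a
  haveI := isStrictlyGE_singleColumnBicomplex ((sysBicomplex P).X a)
  haveI := isStrictlyGE_cechTricomplex_flip_X Q 0 a
  exact quasiIso_total_map_of_quasiIso_rows_of_isStrictlyGE _ _ (colAugment ε hε a) 0 0
    (fun q => isStrictlyGE_singleColumnBicomplex_X _ 0 q) (fun q => isStrictlyGE_sysBicomplex_X (Q.X q) a) hrow

/-- The columns of `resAugment` are quasi-isomorphisms under (H1′). [cite: StacksProject, Tag 0133] -/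
theorem quasiIso_resAugment_f [Q.IsStrictlyGE 0] (a : ℤ)
    (hrow : ∀ b : ℤ, QuasiIso (((HomologicalComplex₂.flipFunctor _ (ComplexShape.up ℤ) (ComplexShape.up ℤ)).map
      (colAugment ε hε a)).f b)) : QuasiIso ((resAugment ε hε).f a) := by
  haveI := isIso_ιTotalSingleColumn ((sysBicomplex P).X a)
  haveI := quasiIso_total_map_colAugment_of_rows ε hε a hrow
  rw [resAugment_f]
  infer_instance

/-- **`Tot Č•,•(P) ⟶ Tot V` is a quasi-isomorphism under (H1′) for all `a`**, for `Q` in degrees `≥ 0` (columns criterion).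
[cite: StacksProject, Tag 0133] [cite: Weibel1994, 5.6.1–5.6.2] -/
theorem quasiIso_total_map_resAugment [Q.IsStrictlyGE 0]
    (hrow : ∀ a b : ℤ, QuasiIso (((HomologicalComplex₂.flipFunctor _ (ComplexShape.up ℤ) (ComplexShape.up ℤ)).map
      (colAugment ε hε a)).f b)) :
    QuasiIso (HomologicalComplex₂.total.map (resAugment ε hε) (ComplexShape.up ℤ)) := by
  haveI := isStrictlyGE_sysBicomplex P
  haveI := isStrictlyGE_cechTotBicomplex Q
  exact quasiIso_total_map_of_quasiIso_columns_of_isStrictlyGE _ _ (resAugment ε hε) 0 0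
    (fun a => isStrictlyGE_sysBicomplex_X P a) (fun a => isStrictlyGE_cechTotBicomplex_X Q a)
    fun a => quasiIso_resAugment_f ε hε a (hrow a)

/-! ### §3 The comparison `Hⁿ(Tot Č•,•(P)) ≅ Hⁿ(q ↦ Q^q ∅ ∅)` -/

/-- **`Hⁿ(Tot Č•,•(P)) ≅ Hⁿ(Γ•)`** for a resolution datum `ε : P ⟶ Q⁰` (`Q` in degrees `≥ 0`) satisfying (H1′) (rows of the
`colAugment`s are quasi-isomorphisms), (H2col) (every column of every `Č•,•(Q^q)` is Čech-resolved by its empty member) and (H2∅)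
(every `Q^q(·, ∅)` is Čech-resolved by `Q^q ∅ ∅`): the zig-zag `Tot Č•,•(P) ⟶ Tot V ⟵ Tot(W'ᶠˡⁱᵖ) ≅ Tot W' ⟵ Γ•` of quasi-isomorphisms
(and Mathlib's `totalFlipIso`) in homology. [cite: StacksProject, Tag 0BEC] [cite: StacksProject, Tag 0133] [cite: Weibel1994, 2.7.3] -/
def homologyIsoEmptyComplex [Q.IsStrictlyGE 0]
    (hrow : ∀ a b : ℤ, QuasiIso (((HomologicalComplex₂.flipFunctor _ (ComplexShape.up ℤ) (ComplexShape.up ℤ)).map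
      (colAugment ε hε a)).f b))
    (hcol : ∀ q a : ℤ, QuasiIso (sysAugmentHom (cochainSystem (Q.X q) a)))
    (hempty : ∀ q : ℤ, QuasiIso (sysAugmentHom ((Q.X q).flip.obj ∅))) (n : ℤ) :
    ((sysBicomplex P).total (ComplexShape.up ℤ)).homology n ≅ (emptyComplex Q).homology n :=
  haveI := quasiIso_total_map_resAugment ε hε hrow
  haveI := quasiIso_total_map_colTotAugment Q hcol
  haveI := quasiIso_emptyToTotal Q hempty
  isoOfQuasiIsoAt (HomologicalComplex₂.total.map (resAugment ε hε) (ComplexShape.up ℤ)) n ≪≫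
    (isoOfQuasiIsoAt (HomologicalComplex₂.total.map (colTotAugment Q) (ComplexShape.up ℤ)) n).symm ≪≫
      ((homologyFunctor (ModuleCat.{u} A) (ComplexShape.up ℤ) n).mapIso
        ((emptyColBicomplex Q).flip.totalFlipIso (ComplexShape.up ℤ))).symm ≪≫
        (isoOfQuasiIsoAt (emptyToTotal Q) n).symm

end OrderedCech

end Literature.Algebra.Homology

end
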